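import Literature.NumberTheory.CubicFields.FundCubicFieldCountSieve
import HarnessLib

/-!
# `N^±(X, Ψ_{q²})` as partial sums of the coefficients of a congruence Shintani zeta function `ξ^±(s, Φ_q)`

Topic `Literature/NumberTheory/CubicFields`; glue between the tree's sieve count
`FundCubicFieldCountSieve.nonFundCount s q X` (BTT §5's `N^±(X, Ψ_{q²})`, spelled through local
fundamentality of the discriminant) and the tree's congruence Shintani zeta functions
`ShintaniZeta.shintaniZetaMod Φ sgn s = Σ_n a^±(Φ, n) n^{-s}` for a function `Φ : V(ℤ/mℤ) → ℂ`
(BTT §2.4 (12)) — the objects Landau's method (BTT Thm 3.1/3.2) is about.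

Bhargava–Taniguchi–Thorne 2023, §5: `Ψ_{q²} := ⊗_{p ∣ q} Ψ_{p²}` viewed as a function
`V(ℤ/q²ℤ) → {0,1}`, and `N^±(X, Φ) := Σ_{n<X} a^±(Φ, n)` (Thm 3.1 (17)); Thm 3.1 requires `Φ_m` to be
`GL₂(ℤ/mℤ)`-invariant. Here, at level `m = 16q²` (the condition at `2` is read modulo `16`):

* `IsNonFundModAt p D` (`D ∈ ℤ/mℤ`) — the local condition read modulo `p²` (odd `p`) / `16` (`p = 2`),
  and `isNonFundModAt_intCast_iff` — on an integer it is `¬ IsFundAt p D`;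
* `psiMod q : BinaryCubic (ZMod (16 q²)) → ℂ` — **`Φ_q = Ψ_{q²}`** as a genuine function on `V(ℤ/mℤ)`;
  `psiMod_twist`, `psiMod_subst` — it is invariant under every unit-determinant matrix over `ℤ/mℤ`
  (for the twisted and the plain substitution action: `Disc` changes by a unit square);
* `shintaniCoeffMod_psiMod` — **`a^s(Φ_q, n) = [s·n not loc. fund. at every p ∣ q] · a(s·n)`** (`n ≥ 1`);
* **`nonFundCount_eq_sum_shintaniCoeffMod`** — `N^s(X, Ψ_{q²}) = Σ_{1 ≤ n < X} a^s(Φ_q, n)`: the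
  quantity in `FundCubicFieldCountLandau.LandauShintaniData.landau` is literally the partial sum of the
  Dirichlet coefficients of `ξ^s(·, Φ_q) = shintaniZetaMod (psiMod q) s`.

## References

* M. Bhargava, T. Taniguchi, F. Thorne, *Improved error estimates for the Davenport–Heilbronn
  theorems*, Math. Ann. 389 (2024) = arXiv:2107.12819, §2.4 (12), Thm 3.1 (17), §5 (Ψ_{q²})
  [BhargavaTaniguchiThorne2023].
-/

noncomputable section

open Finset

namespace Literature.NumberTheory.CubicFields

open BinaryCubic RingOfForm Literature.NumberTheory.QuadraticFields Classical

/-! ### The local condition read modulo `m` -/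

/-- The residues modulo `16` of the integers locally fundamental at `2` (`≡ 1 (4)` or `≡ 8, 12 (16)`). [folklore] -/
def fundResiduesSixteen : Finset (ZMod 16) := {1, 5, 9, 13, 8, 12}

/-- **"`D` not locally fundamental at `p`", read on `ℤ/mℤ`**: at odd `p`, `D ≡ 0 (mod p²)`; at `p = 2`,
`D mod 16 ∉ {1, 5, 9, 13, 8, 12}` (meaningful when `p² ∣ m`, resp. `16 ∣ m`). [folklore] -/
def IsNonFundModAt (p : ℕ) {m : ℕ} (D : ZMod m) : Prop :=
  if p = 2 then (D.cast : ZMod 16) ∉ fundResiduesSixteen else (D.cast : ZMod (p ^ 2)) = 0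

/-- Modulo `16`: `D ∈ {1,5,9,13,8,12}` iff `D ≡ 1 (4)` or `D ≡ 8, 12 (16)`. [folklore] -/
theorem intCast_mem_fundResiduesSixteen_iff (D : ℤ) :
    ((D : ZMod 16)) ∈ fundResiduesSixteen ↔ (D % 4 = 1 ∨ D % 16 = 8 ∨ D % 16 = 12) := by
  have h16 : ((D : ZMod 16)) = ((D % 16 : ℤ) : ZMod 16) := (ZMod.intCast_mod D 16).symm
  have h4 : D % 4 = D % 16 % 4 := (Int.emod_emod_of_dvd D (by norm_num : (4 : ℤ) ∣ 16)).symm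
  rw [h16, h4]
  have hlo : 0 ≤ D % 16 := Int.emod_nonneg D (by norm_num)
  have hhi : D % 16 < 16 := Int.emod_lt_of_pos D (by norm_num)
  generalize D % 16 = r at hlo hhi
  interval_cases r <;> decide

/-- **On integers the modular condition is local non-fundamentality**: for `p = 2` with `16 ∣ m`, or
`p ≠ 2` with `p² ∣ m`, `IsNonFundModAt p (D mod m) ⟺ ¬ IsFundAt p D`. [folklore] -/
theorem isNonFundModAt_intCast_iff {p m : ℕ} (h2 : p = 2 → 16 ∣ m) (hp : p ≠ 2 → p ^ 2 ∣ m) (D : ℤ) :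
    IsNonFundModAt p ((D : ZMod m)) ↔ ¬ IsFundAt p D := by
  unfold IsNonFundModAt
  by_cases hp2 : p = 2
  · subst hp2
    rw [if_pos rfl, ZMod.cast_intCast (h2 rfl), intCast_mem_fundResiduesSixteen_iff, isFundAt_two]
  · rw [if_neg hp2, ZMod.cast_intCast (hp hp2), ZMod.intCast_zmod_eq_zero_iff_dvd, isFundAt_of_ne_two hp2, not_not]
    push_cast
    exact Iff.rfl

/-- Units of `ℤ/16` have square `1` or `9`. [folklore] -/
theorem sq_eq_one_or_nine_of_mul_eq_one : ∀ w w' : ZMod 16, w * w' = 1 → w ^ 2 = 1 ∨ w ^ 2 = 9 := by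
  decide

/-- Multiplication by `9` preserves the fundamental residues modulo `16`. [folklore] -/
theorem nine_mul_mem_fundResiduesSixteen_iff : ∀ E : ZMod 16, 9 * E ∈ fundResiduesSixteen ↔ E ∈ fundResiduesSixteen := by
  decide

/-- **The modular condition is invariant under unit squares**: `IsNonFundModAt p (w² D) ⟺ IsNonFundModAt p D`
for a unit `w` of `ℤ/mℤ` (`16 ∣ m` if `p = 2`, `p² ∣ m` otherwise). [folklore] -/
theorem isNonFundModAt_unit_sq_mul_iff {p m : ℕ} (h2 : p = 2 → 16 ∣ m) (hp : p ≠ 2 → p ^ 2 ∣ m)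
    {w : ZMod m} (hw : IsUnit w) (D : ZMod m) : IsNonFundModAt p (w ^ 2 * D) ↔ IsNonFundModAt p D := by
  unfold IsNonFundModAt
  by_cases hp2 : p = 2
  · subst hp2
    rw [if_pos rfl, if_pos rfl]
    haveI : CharP (ZMod 16) 16 := ZMod.charP 16
    have hcast : ((w ^ 2 * D : ZMod m).cast : ZMod 16) = (ZMod.castHom (h2 rfl) (ZMod 16) w) ^ 2 * (D.cast : ZMod 16) := by
      rw [ZMod.cast_mul (h2 rfl), ZMod.cast_pow (h2 rfl), ZMod.castHom_apply]
    rw [hcast]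
    obtain ⟨u, hu⟩ := hw.map (ZMod.castHom (h2 rfl) (ZMod 16))
    rcases sq_eq_one_or_nine_of_mul_eq_one (ZMod.castHom (h2 rfl) (ZMod 16) w) ↑u⁻¹ (by rw [← hu, Units.mul_inv]) with h1 | h9
    · rw [h1, one_mul]
    · rw [h9, nine_mul_mem_fundResiduesSixteen_iff]
  · rw [if_neg hp2, if_neg hp2]
    haveI : CharP (ZMod (p ^ 2)) (p ^ 2) := ZMod.charP _
    have hcast : ((w ^ 2 * D : ZMod m).cast : ZMod (p ^ 2)) = (ZMod.castHom (hp hp2) (ZMod (p ^ 2)) w) ^ 2 * (D.cast : ZMod (p ^ 2)) := by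
      rw [ZMod.cast_mul (hp hp2), ZMod.cast_pow (hp hp2), ZMod.castHom_apply]
    rw [hcast]
    have hu : IsUnit ((ZMod.castHom (hp hp2) (ZMod (p ^ 2)) w) ^ 2) := (hw.map _).pow 2
    exact hu.mul_right_eq_zero

/-! ### `Φ_q = Ψ_{q²}` on `V(ℤ/16q²ℤ)` -/

/-- **`Φ_q = Ψ_{q²} : V(ℤ/16q²ℤ) → {0, 1}`** (BTT §5, second definition, `Σ_p = A'_p`): the indicator
of the forms whose discriminant is non-fundamental modulo `p²` (odd `p ∣ q`) and modulo `16`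
(`2 ∣ q`) at every prime `p ∣ q`. [cite: BhargavaTaniguchiThorne2023, §5 (Ψ_{q²} := ⊗_{p∣q} Ψ_{p²} as a function on V(ℤ/q²ℤ))] -/
def psiMod (q : ℕ) (x : BinaryCubic (ZMod (16 * q ^ 2))) : ℂ :=
  if ∀ p ∈ q.primeFactors, IsNonFundModAt p x.disc then 1 else 0

/-- `Φ_q` takes the values `0, 1` (in particular it is nonnegative real, as Thm 3.1 requires). [folklore] -/
theorem psiMod_eq_zero_or_one (q : ℕ) (x : BinaryCubic (ZMod (16 * q ^ 2))) : psiMod q x = 0 ∨ psiMod q x = 1 := by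
  unfold psiMod; split_ifs <;> simp

/-- The divisibilities making the local conditions well defined at level `16q²`: `16 ∣ 16q²` and
`p² ∣ 16q²` for `p ∣ q`. [folklore] -/
theorem level_dvd {q p : ℕ} (hp : p ∈ q.primeFactors) : (p = 2 → 16 ∣ 16 * q ^ 2) ∧ (p ≠ 2 → p ^ 2 ∣ 16 * q ^ 2) :=
  ⟨fun _ => dvd_mul_right 16 _, fun _ => (pow_dvd_pow_of_dvd (Nat.dvd_of_mem_primeFactors hp) 2).trans (dvd_mul_left _ _)⟩

/-- **On the reduction of an integral form, `Φ_q` is the sieve condition of `nonFundCount`**: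
`Φ_q(f mod 16q²) = [Disc f not locally fundamental at every p ∣ q]`. [folklore] -/
theorem psiMod_map (q : ℕ) (f : BinaryCubic ℤ) :
    psiMod q (f.map (Int.castRingHom (ZMod (16 * q ^ 2)))) =
      if ∀ p ∈ q.primeFactors, ¬ IsFundAt p f.disc then 1 else 0 := by
  unfold psiMod
  rw [disc_map, eq_intCast]
  have hiff : (∀ p ∈ q.primeFactors, IsNonFundModAt p ((f.disc : ZMod (16 * q ^ 2)))) ↔
      ∀ p ∈ q.primeFactors, ¬ IsFundAt p f.disc :=
    forall₂_congr fun p hp => isNonFundModAt_intCast_iff (level_dvd hp).1 (level_dvd hp).2 f.disc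
  by_cases h : ∀ p ∈ q.primeFactors, ¬ IsFundAt p f.disc
  · rw [if_pos h, if_pos (hiff.mpr h)]
  · rw [if_neg h, if_neg (mt hiff.mp h)]

/-- **`Φ_q` is invariant under the twisted action of every unit-determinant matrix over `ℤ/16q²ℤ`**
(`Disc(γ·x) = (det γ)¹⁰ Disc x`, a unit square) — the `GL₂(ℤ/mℤ)`-invariance required in BTT Thm 3.1.
[cite: BhargavaTaniguchiThorne2023, §2.4 (Φ_m(γx) = Φ_m(x) for all γ ∈ GL₂(ℤ/mℤ))] -/
theorem psiMod_twist (q : ℕ) {γ : Matrix (Fin 2) (Fin 2) (ZMod (16 * q ^ 2))} (hγ : IsUnit γ.det)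
    (x : BinaryCubic (ZMod (16 * q ^ 2))) : psiMod q (twist γ x) = psiMod q x := by
  unfold psiMod
  rw [disc_twist, show γ.det ^ 10 = (γ.det ^ 5) ^ 2 by ring]
  have hiff : (∀ p ∈ q.primeFactors, IsNonFundModAt p ((γ.det ^ 5) ^ 2 * x.disc)) ↔
      ∀ p ∈ q.primeFactors, IsNonFundModAt p x.disc :=
    forall₂_congr fun p hp => isNonFundModAt_unit_sq_mul_iff (level_dvd hp).1 (level_dvd hp).2 (hγ.pow 5) x.disc
  by_cases h : ∀ p ∈ q.primeFactors, IsNonFundModAt p x.disc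
  · rw [if_pos h, if_pos (hiff.mpr h)]
  · rw [if_neg h, if_neg (mt hiff.mp h)]

/-- … and under the plain substitution action `x ↦ x ∘ γ` (`Disc(x ∘ γ) = (det γ)⁶ Disc x`), hence
under any normalisation of the `GL₂(ℤ/mℤ)`-action. [folklore] -/
theorem psiMod_subst (q : ℕ) {γ : Matrix (Fin 2) (Fin 2) (ZMod (16 * q ^ 2))} (hγ : IsUnit γ.det)
    (x : BinaryCubic (ZMod (16 * q ^ 2))) : psiMod q (x.subst γ) = psiMod q x := by
  unfold psiMod
  rw [disc_subst, show γ.det ^ 6 = (γ.det ^ 3) ^ 2 by ring]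
  have hiff : (∀ p ∈ q.primeFactors, IsNonFundModAt p ((γ.det ^ 3) ^ 2 * x.disc)) ↔
      ∀ p ∈ q.primeFactors, IsNonFundModAt p x.disc :=
    forall₂_congr fun p hp => isNonFundModAt_unit_sq_mul_iff (level_dvd hp).1 (level_dvd hp).2 (hγ.pow 3) x.disc
  by_cases h : ∀ p ∈ q.primeFactors, IsNonFundModAt p x.disc
  · rw [if_pos h, if_pos (hiff.mpr h)]
  · rw [if_neg h, if_neg (mt hiff.mp h)]

/-! ### The coefficients `a^s(Φ_q, n)` and `N^s(X, Ψ_{q²})` -/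

/-- **`a^s(Φ_q, n) = [s·n not loc. fund. at every p ∣ q] · a(s·n)`** for `n ≥ 1`: on an orbit of
discriminant `s·n` the weight `Φ_q` is the constant `[T_q(s·n)]`. [cite: BhargavaTaniguchiThorne2023, §2.4 (12) (a^±(Φ_m, n))] -/
theorem shintaniCoeffMod_psiMod {s : ℤ} (hs : s = 1 ∨ s = -1) (q : ℕ) {n : ℕ} (hn : n ≠ 0) :
    shintaniCoeffMod (psiMod q) s n =
      if ∀ p ∈ q.primeFactors, ¬ IsFundAt p (s * n) then ((shintaniCoeffReal (s * n) : ℝ) : ℂ) else 0 := by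
  have hD : (s * n : ℤ) ≠ 0 := by
    rcases hs with rfl | rfl <;> simp [hn]
  haveI := finite_orbitsOfDisc hD
  haveI : Fintype (orbitsOfDisc (s * n)) := Fintype.ofFinite _
  unfold shintaniCoeffMod shintaniCoeffWith
  rw [finsum_eq_sum_of_fintype]
  have hterm : ∀ O : orbitsOfDisc (s * (n : ℤ)),
      psiMod q ((orbitRep O).map (Int.castRingHom (ZMod (16 * q ^ 2)))) / (stabCard (orbitRep O) : ℂ) =
        (if ∀ p ∈ q.primeFactors, ¬ IsFundAt p (s * n) then (1 : ℂ) else 0) * (((stabCard (orbitRep O) : ℝ))⁻¹ : ℝ) := by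
    intro O
    rw [psiMod_map, (orbitRep_spec O).2]
    push_cast
    ring
  rw [Finset.sum_congr rfl fun O _ => hterm O, ← Finset.mul_sum]
  split_ifs
  · rw [one_mul, shintaniCoeffReal_eq_sum]; push_cast; rfl
  · rw [zero_mul]

/-- **`N^s(X, Ψ_{q²}) = Σ_{1 ≤ n < X} a^s(Φ_q, n)`**: the tree's sieve count is the partial sum of the
Dirichlet coefficients of the congruence Shintani zeta function `ξ^s(·, Φ_q) = shintaniZetaMod (psiMod q) s`
(BTT Thm 3.1 (17): `N^±(X, Φ_m) := Σ_{n<X} a^±(Φ_m, n)`). [cite: BhargavaTaniguchiThorne2023, Thm 3.1 (17) with §5 (N^±(X, Ψ_{q²}))] -/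
theorem nonFundCount_eq_sum_shintaniCoeffMod {s : ℤ} (hs : s = 1 ∨ s = -1) (q X : ℕ) :
    ((nonFundCount s q X : ℝ) : ℂ) = ∑ n ∈ Finset.Ico 1 X, shintaniCoeffMod (psiMod q) s n := by
  rw [Finset.sum_congr rfl fun n hn => shintaniCoeffMod_psiMod hs q (by have := (Finset.mem_Ico.mp hn).1; omega)]
  unfold nonFundCount
  rw [Finset.sum_filter]
  push_cast
  -- reindex `D = s·n`, `n = s·D`
  refine Finset.sum_bij' (fun D _ => (s * D).toNat) (fun n _ => s * (n : ℤ)) ?_ ?_ ?_ ?_ ?_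
  · intro D hD
    have h := (mem_discWindow hs).mp hD
    rw [Finset.mem_Ico]
    constructor
    · have : 1 ≤ (s * D).toNat := by have := Int.toNat_of_nonneg h.1.le; omega
      exact this
    · have h2 : ((s * D).toNat : ℤ) < X := by rw [Int.toNat_of_nonneg h.1.le]; exact h.2
      exact_mod_cast h2
  · intro n hn
    rw [Finset.mem_Ico] at hn
    rw [mem_discWindow hs]
    have hss : s * (s * (n : ℤ)) = n := by rcases hs with rfl | rfl <;> ring
    rw [hss]
    exact ⟨by exact_mod_cast hn.1, by exact_mod_cast hn.2⟩
  · intro D hD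
    have h := (mem_discWindow hs).mp hD
    rw [Int.toNat_of_nonneg h.1.le]
    rcases hs with rfl | rfl <;> ring
  · intro n hn
    have hss : s * (s * (n : ℤ)) = n := by rcases hs with rfl | rfl <;> ring
    rw [hss, Int.toNat_natCast]
  · intro D hD
    have h := (mem_discWindow hs).mp hD
    have hsD : (s * ((s * D).toNat : ℤ) : ℤ) = D := by
      rw [Int.toNat_of_nonneg h.1.le]; rcases hs with rfl | rfl <;> ring
    rw [hsD]
    split_ifs <;> simp

/-- Real form: `nonFundCount s q X = (Σ_{1 ≤ n < X} a^s(Φ_q, n)).re`. [folklore] -/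
theorem nonFundCount_eq_re_sum_shintaniCoeffMod {s : ℤ} (hs : s = 1 ∨ s = -1) (q X : ℕ) :
    nonFundCount s q X = (∑ n ∈ Finset.Ico 1 X, shintaniCoeffMod (psiMod q) s n).re := by
  rw [← nonFundCount_eq_sum_shintaniCoeffMod hs, Complex.ofReal_re]

end Literature.NumberTheory.CubicFields

end
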